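import Summits.BirchSwinnertonDyer.Rank1Residual.X10.ResidualSelmerParity
import HarnessLib

/-!
# The GENERATOR TEST (G) for the residual Selmer structure (MR07 Prop. 1.3 (i) + Thm. 1.4, `#T = 1`)
# (cell `b2b-bsdres`, unit `b2b-bsdres-x10` = N2 class lead, GEN 30; TOOL — theorems only over
# ABSTRACT localisation data; no named fact; nothing booked; file 3 of 4)

HONEST FRAMING (run/shared/lean/b2b/bsd-rank1-residual/, verbatim in every file): the goal of the
cell is to DELETE the COMBINATION-SHAPED residual classes of the Birch–Swinnerton-Dyer formula for
ALL analytic-rank `≤ 1` elliptic curves over `ℚ` — "full BSD formula for every rank `≤ 1` curve in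
class `C`" assembled STRICTLY from published theorems — so that the rank-`≤ 1` remainder becomes
exactly the CONSTRUCTION-SHAPED classes, which are TYPED (missing-input `Prop`s), NOT attempted.
This is not "finishing BSD". Class X10b (= N2) keeps its label CONSTRUCTION-SHAPED (NEEDS `X_A3`,
referee R82.3 / RESIDUAL-MAP §I N2); this file is a TOOL; no mark / label / tier / count moves.

## What

With `𝒮` a quadratic Selmer structure of a global metabolic structure `𝓆` (KMR 2013 §3, tree file
`QuadraticSelmerStructure.lean`), `𝒮⁰ = residual 𝒮 P hP` its residual structure (file 2,
`X10/ResidualSelmerParity.lean`) and `H¹_{𝒮+𝒮⁰}` (file 1, `X10/SelmerStructureSum.lean`, Mazur–Rubin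
2007 Prop. 1.3 (i)): if `dim H¹_𝒮 = 1` with generator `c`, and off `P` the local condition of `𝒮` is
the unramified one except at ONE place `v₀ ∈ S \ P` where `dim W_{v₀}/(W_{v₀} ∩ Λ_{v₀}) = 1`, then

* `finrank_sumSelmerGroup_residual_eq`: `dim H¹_{𝒮+𝒮⁰} = dim (H¹_𝒮 ∩ H¹_{𝒮⁰}) + 1` (Prop. 1.3 (i));
* `residual_selmerGroup_eq_bot_of_generator_not_mem`: `loc_{v₀} c ∉ Λ_{v₀}` ⟹ `H¹_{𝒮⁰} = 0`
  (`H¹_𝒮 ∩ H¹_{𝒮⁰} = 0`, so `dim H¹_{𝒮+𝒮⁰} = 1 ≥ dim H¹_{𝒮⁰}`, and (P) makes `dim H¹_{𝒮⁰}` even);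
* `finrank_residual_selmerGroup_eq_two_of_generator_mem`: `loc_{v₀} c ∈ Λ_{v₀}` ⟹ `dim H¹_{𝒮⁰} = 2`
  (`c ∈ H¹_{𝒮⁰}`, `dim H¹_{𝒮⁰} ≤ dim H¹_{𝒮+𝒮⁰} ≤ 2`, even);
* `mem_residual_selmerGroup_of_forall_mem` / `exists_not_mem_of_residual_selmerGroup_eq_bot` — the
  WEAK form for several exceptional places (`H¹_{𝒮⁰} = 0` ⟹ a non-zero Selmer class is ramified on `T`);
* over `𝔽_p` in the order currency: `natCard_residual_selmerGroup_eq_one_of_generator_not_mem`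
  (`#H¹_𝒮 = p` ⟹ `#H¹_{𝒮⁰} = 1`) and `natCard_residual_selmerGroup_eq_sq_of_generator_mem` (`= p²`).

This is the N2 memo's test (G) (TRIVIAL-ROADS-x10g27.md §1, §3, §9), abstractly: for `E′/ℚ` of
rank `1`, good at `3`, `E′(ℚ)[3] = 0`, `dim Sel₃(E′) = 1` (`Sel₃ = ⟨κ(P)⟩`, `P` a generator) and
`T_{E′} = {ℓ}`: `S⁰(E′[3]) = 0` iff `κ(P)_ℓ ∉ H¹_ur`, i.e. iff `P ∉ 3E′(ℚ_ℓ)` (its component in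
`Φ_ℓ = ℤ/c_ℓ` is prime to `3`), else `dim S⁰ = 2` — the decision `S⁰(118810q1) = 0` through the twin
`118810j1` at `ℓ = 5` (generator `(187/9, 3262/27)` reduces to the node). The instance itself (the
global metabolic structure on `H¹(ℚ, E[3])`, Kummer conditions, Poitou–Tate) is NOT built here
(P-SPEC (I1)–(I6), file 2's docstring); this file is the algebra, fact-free, any field.

## References

* [KlagsbrunMazurRubin2013] Z. Klagsbrun, B. Mazur, K. Rubin, *Disparity in Selmer ranks of
  quadratic twists of elliptic curves*, Ann. of Math. 178 (2013), §2 (Lemma 2.2, Prop. 2.4), §3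
  (Thm. 3.1, Def. 3.3, Lemma 3.4, Def. 3.8, Thm. 3.9), §5 (Lemma 5.3) — arXiv:1111.2321, read.
* [MazurRubin2007] B. Mazur, K. Rubin, *Finding large Selmer rank via an arithmetic theory of local
  constants*, Ann. of Math. 166 (2007), Def. 1.2, Prop. 1.3, Thm. 1.4, Prop. 2.1 —
  arXiv:math/0512085 pp. 5–6, read (verbatim in HOME/class-closure/N2/TRIVIAL-ROADS-x10g27.md §1).
* HOME/class-closure/N2/{TRIVIAL-ROADS-x10g27.md §§1–3, §9; P-SPEC-x10g29.md}; HOME/X10-AUDIT.md §§33–36.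
-/

set_option autoImplicit false

noncomputable section

open Module QuadraticMap Literature.LinearAlgebra.QuadraticForm Literature.NumberTheory.EllipticCurves
open Summit.BirchSwinnertonDyer.Rank1Residual.X10.SelmerStructureSum
open Summit.BirchSwinnertonDyer.Rank1Residual.X10.ResidualSelmerParity

namespace Summit.BirchSwinnertonDyer.Rank1Residual.X10.ResidualSelmerGeneratorTest

universe u v w x

/-! ### §5. (G): the generator test (MR07 Prop. 1.3 (i) + Thm. 1.4 with `#T = 1`) -/

section GeneratorTest

variable {F : Type u} [Field F] {ι : Type v} [DecidableEq ι] {H : Type w} [AddCommGroup H]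
  [Module F H] {L : ι → Type x} [∀ v, AddCommGroup (L v)] [∀ v, Module F (L v)]
  [∀ v, FiniteDimensional F (L v)]
  {loc : ∀ v, H →ₗ[F] L v} {Λ : ∀ v, Submodule F (L v)} {S₀ : Finset ι}
  {𝓆 : GlobalMetabolicStructure loc Λ S₀} (𝒮 : QuadraticSelmerStructure 𝓆) {P S : Finset ι}
  {v₀ : ι} (hP : S₀ ⊆ P)

/-- One exceptional place: with `W_v = Λ_v` off `P ∪ {v₀}` and local term `1` at `v₀ ∈ S \ P`,
`dim H¹_{𝒮+𝒮⁰} = dim (H¹_𝒮 ∩ H¹_{𝒮⁰}) + 1` (MR07 Prop. 1.3 (i) with `S = {v₀}`).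
[cite: MazurRubin2007, Prop. 1.3 (i)] -/
theorem finrank_sumSelmerGroup_residual_eq (hPS : P ⊆ S) (hS : 𝒮.places ⊆ S) (hv₀ : v₀ ∈ S \ P)
    (hoff : ∀ v ∈ S \ P, v ≠ v₀ → 𝒮.W v = Λ v)
    (hv₀d : finrank F (𝒮.W v₀) = finrank F ↥(𝒮.W v₀ ⊓ Λ v₀) + 1)
    (hfin : FiniteDimensional F (unramifiedOutside loc Λ S)) (hPT : 𝓆.IsSelfDualAt S) :
    finrank F ↥(sumSelmerGroup 𝒮 (residual 𝒮 P hP)) =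
      finrank F ↥(𝒮.selmerGroup ⊓ (residual 𝒮 P hP).selmerGroup) + 1 := by
  have h := finrank_sumSelmerGroup_eq 𝒮 (residual 𝒮 P hP) hS hPS hfin hPT
  have hsum : ∑ v ∈ S, (finrank F (𝒮.W v) - finrank F ↥(𝒮.W v ⊓ (residual 𝒮 P hP).W v)) = 1 := by
    rw [← Finset.sum_sdiff hPS]
    have hP0 : ∑ v ∈ P, (finrank F (𝒮.W v) - finrank F ↥(𝒮.W v ⊓ (residual 𝒮 P hP).W v)) = 0 :=
      Finset.sum_eq_zero fun v hv => by rw [residual_W_of_mem 𝒮 hP hv, inf_idem, Nat.sub_self]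
    rw [hP0, add_zero, Finset.sum_eq_single_of_mem v₀ hv₀ fun v hv hne => ?_]
    · rw [residual_W_of_not_mem 𝒮 hP (Finset.mem_sdiff.mp hv₀).2, hv₀d]
      omega
    · rw [residual_W_of_not_mem 𝒮 hP (Finset.mem_sdiff.mp hv).2, hoff v hv hne, inf_idem,
        Nat.sub_self]
  rw [h, hsum]

omit [∀ v, FiniteDimensional F (L v)] in
/-- Off `P` and away from `v₀`, the local condition of `𝒮` is the unramified one at EVERY place
(inside `S` by hypothesis, outside `S ⊇ Σ_𝒮` by definition of a Selmer structure). [folklore] -/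
theorem W_eq_unramified_of_ne (hS : 𝒮.places ⊆ S) (hoff : ∀ v ∈ S \ P, v ≠ v₀ → 𝒮.W v = Λ v)
    {v : ι} (hvP : v ∉ P) (hne : v ≠ v₀) : 𝒮.W v = Λ v := by
  by_cases hvS : v ∈ S
  · exact hoff v (Finset.mem_sdiff.mpr ⟨hvS, hvP⟩) hne
  · exact 𝒮.eq_unramified v fun h => hvS (hS h)

/-- **(G), case "generator ramified at `v₀`": `H¹_{𝒮⁰} = 0`.** `dim H¹_𝒮 = 1` with generator `c`,
`W_v = Λ_v` off `P ∪ {v₀}`, local term `1` at `v₀`, and `loc_{v₀} c ∉ Λ_{v₀}`. Then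
`H¹_𝒮 ∩ H¹_{𝒮⁰} = 0` (a non-zero multiple of `c` is not unramified at `v₀`), so
`dim H¹_{𝒮+𝒮⁰} = 1` by Prop. 1.3 (i), `dim H¹_{𝒮⁰} ≤ 1`, and (P) makes `dim H¹_{𝒮⁰}` even: `= 0`.
THE INSTANCE (MR07 Prop. 1.3 + Thm. 1.4, memo (G)): `E′/ℚ` of rank `1`, good at `3`, `E′(ℚ)[3] = 0`,
`dim Sel₃(E′) = 1` (`Sel₃ = ⟨κ(P)⟩`), `T_{E′} = {ℓ}`, and `κ(P)_ℓ ∉ H¹_ur` (`P ∉ 3E′(ℚ_ℓ)`: its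
component in `Φ_ℓ = ℤ/c_ℓ` is prime to `3`) ⟹ `S⁰(E′[3]) = 0` — `118810j1` at `ℓ = 5`
(`P = (187/9, 3262/27)` reduces to the node), hence `S⁰(118810q1) = 0` along the twin congruence.
[cite: MazurRubin2007, Prop. 1.3 (i) and Thm. 1.4] -/
theorem residual_selmerGroup_eq_bot_of_generator_not_mem (hPS : P ⊆ S) (hS : 𝒮.places ⊆ S)
    (hv₀ : v₀ ∈ S \ P) (hoff : ∀ v ∈ S \ P, v ≠ v₀ → 𝒮.W v = Λ v)
    (hv₀d : finrank F (𝒮.W v₀) = finrank F ↥(𝒮.W v₀ ⊓ Λ v₀) + 1)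
    (hfin : FiniteDimensional F (unramifiedOutside loc Λ S)) (hPT : 𝓆.IsSelfDualAt S)
    (hrank : finrank F 𝒮.selmerGroup = 1) {c : H} (hc : c ∈ 𝒮.selmerGroup) (hc0 : c ≠ 0)
    (hcv : loc v₀ c ∉ Λ v₀) : (residual 𝒮 P hP).selmerGroup = ⊥ := by
  haveI := hfin
  haveI : FiniteDimensional F ↥(sumSelmerGroup 𝒮 (residual 𝒮 P hP)) :=
    Submodule.finiteDimensional_of_le (sumSelmerGroup_le_unramifiedOutside _ _ hS hPS)
  haveI : FiniteDimensional F (residual 𝒮 P hP).selmerGroup :=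
    Submodule.finiteDimensional_of_le ((residual 𝒮 P hP).selmerGroup_le_unramifiedOutside hPS)
  -- `H¹_𝒮 ∩ H¹_{𝒮⁰} = 0`
  have hinf : 𝒮.selmerGroup ⊓ (residual 𝒮 P hP).selmerGroup = ⊥ := by
    rw [Submodule.eq_bot_iff]
    intro x hx
    have hgen := (finrank_eq_one_iff_of_nonzero' (⟨c, hc⟩ : 𝒮.selmerGroup)
      (fun h => hc0 (congrArg Subtype.val h))).mp hrank ⟨x, hx.1⟩
    obtain ⟨a, ha⟩ := hgen
    have hax : a • c = x := congrArg Subtype.val ha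
    by_cases ha0 : a = 0
    · rw [← hax, ha0, zero_smul]
    · exfalso
      have hxv : loc v₀ x ∈ Λ v₀ :=
        ((mem_residual_selmerGroup_iff 𝒮 hP x).mp hx.2).2 v₀ (Finset.mem_sdiff.mp hv₀).2
      rw [← hax, map_smul] at hxv
      exact hcv (by simpa only [inv_smul_smul₀ ha0] using (Λ v₀).smul_mem a⁻¹ hxv)
  -- `dim H¹_{𝒮+𝒮⁰} = 1`, so `dim H¹_{𝒮⁰} ≤ 1`
  have hsum := finrank_sumSelmerGroup_residual_eq 𝒮 hP hPS hS hv₀ hoff hv₀d hfin hPT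
  rw [hinf, finrank_bot, zero_add] at hsum
  have hle : finrank F (residual 𝒮 P hP).selmerGroup ≤ 1 :=
    hsum ▸ Submodule.finrank_mono (selmerGroup_le_sumSelmerGroup_right 𝒮 (residual 𝒮 P hP))
  -- parity: `1 + dim H¹_{𝒮⁰} + 1` is even
  have hev := even_finrank_add_finrank_residual_add_card 𝒮 hP hPS hS
    (Finset.singleton_subset_iff.mpr hv₀)
    (fun v hv hvT => hoff v hv fun h => hvT (Finset.mem_singleton.mpr h))
    (fun v hv => by rw [Finset.mem_singleton.mp hv]; exact hv₀d) hfin hPT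
  rw [hrank, Finset.card_singleton] at hev
  have h0 : finrank F (residual 𝒮 P hP).selmerGroup = 0 := by
    obtain ⟨k, hk⟩ := hev
    omega
  exact Submodule.finrank_eq_zero.mp h0

omit [∀ v, FiniteDimensional F (L v)] in
/-- **(G), weak form for several exceptional places.** If off `P` the local condition of `𝒮` is the
unramified one except on a finite set `T`, then a class `c ∈ H¹_𝒮` that is unramified at every place
of `T` lies in `H¹_{𝒮⁰}`; contrapositively, `H¹_{𝒮⁰} = 0` forces every non-zero `c ∈ H¹_𝒮` to be
RAMIFIED at some `v ∈ T`. THE INSTANCE (memo (G), `#T_{E′} ≥ 2`): `S⁰(E′[3]) = 0 ⟹ κ(P)` is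
non-trivial in `H¹/H¹_ur` at ≥ 1 prime of `T_{E′}` — the weak test on the 7 rank-1 partner-road cells
(memo §2: 12/12 HIT). [cite: MazurRubin2007, Def. 1.2] -/
theorem mem_residual_selmerGroup_of_forall_mem {T : Finset ι} (hS : 𝒮.places ⊆ S)
    (hoff : ∀ v ∈ S \ P, v ∉ T → 𝒮.W v = Λ v) {c : H} (hc : c ∈ 𝒮.selmerGroup)
    (hcT : ∀ v ∈ T, loc v c ∈ Λ v) : c ∈ (residual 𝒮 P hP).selmerGroup := by
  rw [mem_residual_selmerGroup_iff]
  have hc' := (𝒮.mem_selmerGroup_iff c).mp hc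
  refine ⟨fun v _ => hc' v, fun v hvP => ?_⟩
  by_cases hvT : v ∈ T
  · exact hcT v hvT
  · by_cases hvS : v ∈ S
    · rw [← hoff v (Finset.mem_sdiff.mpr ⟨hvS, hvP⟩) hvT]; exact hc' v
    · rw [← 𝒮.eq_unramified v fun h => hvS (hS h)]; exact hc' v

omit [∀ v, FiniteDimensional F (L v)] in
/-- **(G), weak form, contrapositive**: `H¹_{𝒮⁰} = 0` and `0 ≠ c ∈ H¹_𝒮` ⟹ `loc_v c ∉ Λ_v` for some
`v ∈ T`. [cite: MazurRubin2007, Def. 1.2] -/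
theorem exists_not_mem_of_residual_selmerGroup_eq_bot {T : Finset ι} (hS : 𝒮.places ⊆ S)
    (hoff : ∀ v ∈ S \ P, v ∉ T → 𝒮.W v = Λ v) (hbot : (residual 𝒮 P hP).selmerGroup = ⊥) {c : H}
    (hc : c ∈ 𝒮.selmerGroup) (hc0 : c ≠ 0) : ∃ v ∈ T, loc v c ∉ Λ v := by
  by_contra h
  push Not at h
  have hmem := mem_residual_selmerGroup_of_forall_mem 𝒮 hP hS hoff hc h
  rw [hbot, Submodule.mem_bot] at hmem
  exact hc0 hmem

omit [∀ v, FiniteDimensional F (L v)] in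
/-- `c ∈ H¹_𝒮` unramified at `v₀` lies in `H¹_{𝒮⁰}` (when `W_v = Λ_v` off `P ∪ {v₀}`). [folklore] -/
theorem mem_residual_selmerGroup_of_mem (hS : 𝒮.places ⊆ S)
    (hoff : ∀ v ∈ S \ P, v ≠ v₀ → 𝒮.W v = Λ v) {c : H} (hc : c ∈ 𝒮.selmerGroup)
    (hcv : loc v₀ c ∈ Λ v₀) : c ∈ (residual 𝒮 P hP).selmerGroup := by
  rw [mem_residual_selmerGroup_iff]
  have hc' := (𝒮.mem_selmerGroup_iff c).mp hc
  refine ⟨fun v _ => hc' v, fun v hvP => ?_⟩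
  by_cases hne : v = v₀
  · rw [hne]; exact hcv
  · rw [← W_eq_unramified_of_ne 𝒮 hS hoff hvP hne]; exact hc' v

/-- **(G), case "generator unramified at `v₀`": `dim H¹_{𝒮⁰} = 2`.** `dim H¹_𝒮 = 1` with generator
`c`, `W_v = Λ_v` off `P ∪ {v₀}`, local term `1` at `v₀`, and `loc_{v₀} c ∈ Λ_{v₀}`. Then
`c ∈ H¹_{𝒮⁰}`, `dim H¹_{𝒮⁰} ≤ dim H¹_{𝒮+𝒮⁰} = dim (H¹_𝒮 ∩ H¹_{𝒮⁰}) + 1 ≤ 2`, and (P) makes it even: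
`= 2`. THE INSTANCE (memo (G)): a rank-one `E′` as above whose generator IS `3`-divisible in
`E′(ℚ_ℓ)` has `dim S⁰(E′[3]) = 2` (memo §9: `186050n1`, `323008bo1`, `436810cl1`).
[cite: MazurRubin2007, Prop. 1.3 (i) and Thm. 1.4] -/
theorem finrank_residual_selmerGroup_eq_two_of_generator_mem (hPS : P ⊆ S) (hS : 𝒮.places ⊆ S)
    (hv₀ : v₀ ∈ S \ P) (hoff : ∀ v ∈ S \ P, v ≠ v₀ → 𝒮.W v = Λ v)
    (hv₀d : finrank F (𝒮.W v₀) = finrank F ↥(𝒮.W v₀ ⊓ Λ v₀) + 1)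
    (hfin : FiniteDimensional F (unramifiedOutside loc Λ S)) (hPT : 𝓆.IsSelfDualAt S)
    (hrank : finrank F 𝒮.selmerGroup = 1) {c : H} (hc : c ∈ 𝒮.selmerGroup) (hc0 : c ≠ 0)
    (hcv : loc v₀ c ∈ Λ v₀) : finrank F (residual 𝒮 P hP).selmerGroup = 2 := by
  haveI := hfin
  haveI : FiniteDimensional F ↥(sumSelmerGroup 𝒮 (residual 𝒮 P hP)) :=
    Submodule.finiteDimensional_of_le (sumSelmerGroup_le_unramifiedOutside _ _ hS hPS)
  haveI : FiniteDimensional F (residual 𝒮 P hP).selmerGroup :=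
    Submodule.finiteDimensional_of_le ((residual 𝒮 P hP).selmerGroup_le_unramifiedOutside hPS)
  haveI : FiniteDimensional F 𝒮.selmerGroup :=
    Submodule.finiteDimensional_of_le (𝒮.selmerGroup_le_unramifiedOutside hS)
  -- `c ∈ H¹_{𝒮⁰}`, so `1 ≤ dim H¹_{𝒮⁰}`
  have hcres := mem_residual_selmerGroup_of_mem 𝒮 hP hS hoff hc hcv
  have h1 : 1 ≤ finrank F (residual 𝒮 P hP).selmerGroup :=
    Submodule.one_le_finrank_iff.mpr fun h => hc0 (by
      rw [h, Submodule.mem_bot] at hcres; exact hcres)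
  -- `dim H¹_{𝒮⁰} ≤ dim H¹_{𝒮+𝒮⁰} = dim (H¹_𝒮 ∩ H¹_{𝒮⁰}) + 1 ≤ dim H¹_𝒮 + 1 = 2`
  have hsum := finrank_sumSelmerGroup_residual_eq 𝒮 hP hPS hS hv₀ hoff hv₀d hfin hPT
  have hle1 : finrank F ↥(𝒮.selmerGroup ⊓ (residual 𝒮 P hP).selmerGroup) ≤ 1 :=
    hrank ▸ Submodule.finrank_mono inf_le_left
  have hle : finrank F (residual 𝒮 P hP).selmerGroup ≤ 2 :=
    (Submodule.finrank_mono (selmerGroup_le_sumSelmerGroup_right 𝒮 (residual 𝒮 P hP))).trans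
      (by rw [hsum]; omega)
  -- parity
  have hev := even_finrank_add_finrank_residual_add_card 𝒮 hP hPS hS
    (Finset.singleton_subset_iff.mpr hv₀)
    (fun v hv hvT => hoff v hv fun h => hvT (Finset.mem_singleton.mpr h))
    (fun v hv => by rw [Finset.mem_singleton.mp hv]; exact hv₀d) hfin hPT
  rw [hrank, Finset.card_singleton] at hev
  obtain ⟨k, hk⟩ := hev
  omega

end GeneratorTest

/-! #### `F = 𝔽_p`: the generator test in the order currency -/

section GeneratorTestZModP

variable {p : ℕ} [Fact p.Prime] {ι : Type v} [DecidableEq ι] {H : Type w} [AddCommGroup H]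
  [Module (ZMod p) H] {L : ι → Type x} [∀ v, AddCommGroup (L v)] [∀ v, Module (ZMod p) (L v)]
  [∀ v, FiniteDimensional (ZMod p) (L v)]
  {loc : ∀ v, H →ₗ[ZMod p] L v} {Λ : ∀ v, Submodule (ZMod p) (L v)} {S₀ : Finset ι}
  {𝓆 : GlobalMetabolicStructure loc Λ S₀} (𝒮 : QuadraticSelmerStructure 𝓆) {P S : Finset ι}
  {v₀ : ι} (hP : S₀ ⊆ P)

/-- **(G) over `𝔽_p`, ramified generator: `#H¹_{𝒮⁰} = 1`.** `#H¹_𝒮 = p` with generator `c`,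
`loc_{v₀} c ∉ Λ_{v₀}` (hypotheses as in `residual_selmerGroup_eq_bot_of_generator_not_mem`). THE
INSTANCE: `#Sel₃(118810j1) = 3` EXACT (x10b four engines), `T = {5}`, Cremona's generator off the
identity component mod `5` ⟹ `#S⁰ = 1`. [cite: MazurRubin2007, Prop. 1.3 (i) and Thm. 1.4] -/
theorem natCard_residual_selmerGroup_eq_one_of_generator_not_mem (hPS : P ⊆ S)
    (hS : 𝒮.places ⊆ S) (hv₀ : v₀ ∈ S \ P) (hoff : ∀ v ∈ S \ P, v ≠ v₀ → 𝒮.W v = Λ v)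
    (hv₀d : finrank (ZMod p) (𝒮.W v₀) = finrank (ZMod p) ↥(𝒮.W v₀ ⊓ Λ v₀) + 1)
    (hfin : FiniteDimensional (ZMod p) (unramifiedOutside loc Λ S)) (hPT : 𝓆.IsSelfDualAt S)
    (hcard : Nat.card 𝒮.selmerGroup = p) {c : H} (hc : c ∈ 𝒮.selmerGroup) (hc0 : c ≠ 0)
    (hcv : loc v₀ c ∉ Λ v₀) : Nat.card (residual 𝒮 P hP).selmerGroup = 1 := by
  haveI := hfin
  haveI : FiniteDimensional (ZMod p) 𝒮.selmerGroup :=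
    Submodule.finiteDimensional_of_le (𝒮.selmerGroup_le_unramifiedOutside hS)
  have hrank : finrank (ZMod p) 𝒮.selmerGroup = 1 :=
    finrank_eq_of_natCard_eq_pow (p := p) (t := 1) (by rw [hcard, pow_one])
  rw [residual_selmerGroup_eq_bot_of_generator_not_mem 𝒮 hP hPS hS hv₀ hoff hv₀d hfin hPT hrank hc
    hc0 hcv]
  exact Nat.card_unique

/-- **(G) over `𝔽_p`, unramified generator: `#H¹_{𝒮⁰} = p²`.** `#H¹_𝒮 = p` with generator `c`,
`loc_{v₀} c ∈ Λ_{v₀}` (hypotheses as in `finrank_residual_selmerGroup_eq_two_of_generator_mem`).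
[cite: MazurRubin2007, Prop. 1.3 (i) and Thm. 1.4] -/
theorem natCard_residual_selmerGroup_eq_sq_of_generator_mem (hPS : P ⊆ S) (hS : 𝒮.places ⊆ S)
    (hv₀ : v₀ ∈ S \ P) (hoff : ∀ v ∈ S \ P, v ≠ v₀ → 𝒮.W v = Λ v)
    (hv₀d : finrank (ZMod p) (𝒮.W v₀) = finrank (ZMod p) ↥(𝒮.W v₀ ⊓ Λ v₀) + 1)
    (hfin : FiniteDimensional (ZMod p) (unramifiedOutside loc Λ S)) (hPT : 𝓆.IsSelfDualAt S)
    (hcard : Nat.card 𝒮.selmerGroup = p) {c : H} (hc : c ∈ 𝒮.selmerGroup) (hc0 : c ≠ 0)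
    (hcv : loc v₀ c ∈ Λ v₀) : Nat.card (residual 𝒮 P hP).selmerGroup = p ^ 2 := by
  haveI := hfin
  haveI : FiniteDimensional (ZMod p) 𝒮.selmerGroup :=
    Submodule.finiteDimensional_of_le (𝒮.selmerGroup_le_unramifiedOutside hS)
  haveI : FiniteDimensional (ZMod p) (residual 𝒮 P hP).selmerGroup :=
    Submodule.finiteDimensional_of_le ((residual 𝒮 P hP).selmerGroup_le_unramifiedOutside hPS)
  haveI : Finite (residual 𝒮 P hP).selmerGroup := Module.finite_of_finite (ZMod p)
  have hrank : finrank (ZMod p) 𝒮.selmerGroup = 1 :=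
    finrank_eq_of_natCard_eq_pow (p := p) (t := 1) (by rw [hcard, pow_one])
  rw [← Literature.GroupTheory.FiniteAbelian.pow_finrank_eq_natCard p (residual 𝒮 P hP).selmerGroup,
    finrank_residual_selmerGroup_eq_two_of_generator_mem 𝒮 hP hPS hS hv₀ hoff hv₀d hfin hPT hrank hc
      hc0 hcv]

end GeneratorTestZModP

end Summit.BirchSwinnertonDyer.Rank1Residual.X10.ResidualSelmerGeneratorTest

end
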